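import Literature.AlgebraicGeometry.Frobenioids.PreFrobenioidPullbacks
import Literature.AlgebraicGeometry.Frobenioids.ElementaryIsomorphisms
import Literature.AlgebraicGeometry.Frobenioids.ElementaryPreFrobenioid
import Mathlib.Algebra.Group.Units.Hom
import Mathlib.Algebra.Group.Commute.Units
import HarnessLib

/-!
# Frobenioids I, Proposition 1.5 — part 1: isomorphisms, pull-back morphisms and `O^▷(A) ⥲ Φ(A)`
# in `F_Φ` (STEP-0 calibration fragment of the abc-iut cell — proof genre)

Mochizuki, *The geometry of Frobenioids I: the general theory*, Kyushu J. Math. **62** (2008)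
293–400, §1, Proposition 1.5 "(Elementary Frobenioids are Frobenioids)" and its proof, kurims
text p. 27 [cite: MochizukiFrdI2008, Prop. 1.5]:

> "(ii) There is a natural, functorial isomorphism `O^▷(A) ⥲ Φ(A)` [so `O^×(A) ⥲ Φ(A)^±`]
> for objects `A ∈ Ob(F_Φ)`." — proof: "… a morphism of `F_Φ` is a pull-back morphism if and
> only if it is a linear isometry …"

Part 1 of the clause-by-clause verification of Prop. 1.5 against Definition 1.3 (parts 2–3:
`ElementaryClauses.lean`, `ElementaryIsFrobenioid.lean`): the dictionary for the pre-Frobenioid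
`F_Φ → F_{Φ^char}` on triples `(Base, Div, deg_Fr)`, "every object is isotropic, every arrow
co-angular" (the isomorphisms of `F_Φ` are in `ElementaryIsomorphisms.lean`), the pull-back
morphisms (= linear isometries; integrality of `Φ` for one direction), the homomorphism
`N_{≥1} → End(A)`, and Prop. 1.5 (ii): `O^▷(A) ⥲ Φ(A)`, `O^×(A) ⥲ Φ(A)^±` as `α ↦ Div(α)`.
No statement of the paper is strengthened; "natural, functorial" in (ii) is rendered as the
explicit formula `α ↦ Div(α)` together with its use in (iii)(c) (part 2).
-/

namespace Literature.AlgebraicGeometry.Frobenioids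

open CategoryTheory Opposite

universe w v v' u u'

/-! ### Arithmetic in `N_{≥1}` -/

/-- In `N_{≥1}`, `m n = 1` forces `n = 1`. [folklore] -/
private theorem pnat_eq_one_of_mul_eq_one_left {m n : ℕ+} (h : m * n = 1) : n = 1 :=
  PNat.eq (by
    rw [PNat.one_coe]
    exact Nat.eq_one_of_mul_eq_one_left (by rw [← PNat.mul_coe, h, PNat.one_coe]))

namespace ElemFrobenioid

variable {D : Type u} [Category.{v} D] {Φ : Dᵒᵖ ⥤ CommMonCat.{w}}

/-! ### The pre-Frobenioid structure `F_Φ → F_{Φ^char}` on triples: dictionary lemmas -/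

/-- `Base` for the pre-Frobenioid `F_Φ → F_{Φ^char}` is the first component.
[cite: MochizukiFrdI2008, Prop. 1.5] -/
theorem toChar_base_eq {A B : ElemFrobenioid Φ} (φ : A ⟶ B) :
    PreFrobenioid.Base (toChar Φ) φ = Base φ := rfl

/-- `Div` for `F_Φ → F_{Φ^char}` is the class of the zero divisor in `Φ(A)^char`.
[cite: MochizukiFrdI2008, Prop. 1.5] -/
theorem toChar_div_eq {A B : ElemFrobenioid Φ} (φ : A ⟶ B) :
    PreFrobenioid.Div (toChar Φ) φ = Associates.mk (Div φ) := rfl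

/-- `deg_Fr` for `F_Φ → F_{Φ^char}` is the third component. [cite: MochizukiFrdI2008, Prop. 1.5] -/
theorem toChar_degFr_eq {A B : ElemFrobenioid Φ} (φ : A ⟶ B) :
    PreFrobenioid.degFr (toChar Φ) φ = degFr φ := rfl

/-- A morphism of `F_Φ` is an isometry (for `F_Φ → F_{Φ^char}`) iff its zero divisor is a unit.
[cite: MochizukiFrdI2008, Prop. 1.5] -/
theorem toChar_isIsometry_iff {A B : ElemFrobenioid Φ} {φ : A ⟶ B} :
    PreFrobenioid.IsIsometry (toChar Φ) φ ↔ IsUnit (Div φ) :=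
  Associates.mk_eq_one

/-- For a base-isomorphism `ψ` of `F_Φ`, `(ψ^*)⁻¹(Div ψ)` is the class of `(Base ψ)⁻¹^*(Div ψ)`.
[cite: MochizukiFrdI2008, Def. 1.3(iii)] -/
theorem toChar_invDiv {B A : ElemFrobenioid Φ} (ψ : B ⟶ A) [h : IsIso (Base ψ)] :
    PreFrobenioid.invDiv (toChar Φ) ψ h = Associates.mk (pull Φ (inv (Base ψ)) (Div ψ)) :=
  associatesMap_mk _ _


/-! ### Every object of `F_Φ` is isotropic; every morphism is co-angular -/

/-- An isometric pre-step of `F_Φ` is an isomorphism. [cite: MochizukiFrdI2008, Prop. 1.5] -/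
theorem isIso_of_isIsometry_of_isPreStep {A B : ElemFrobenioid Φ} {φ : A ⟶ B}
    (h₁ : PreFrobenioid.IsIsometry (toChar Φ) φ) (h₂ : PreFrobenioid.IsPreStep (toChar Φ) φ) :
    IsIso φ :=
  haveI : IsIso (Base φ) := h₂.2
  isIso_of_base_div_degFr φ (toChar_isIsometry_iff.mp h₁) h₂.1

/-- "all objects of `F_Φ` are … isotropic" (FrdI Prop. 1.5 (i)). [cite: MochizukiFrdI2008, Prop. 1.5] -/
theorem isIsotropic (A : ElemFrobenioid Φ) : PreFrobenioid.IsIsotropic (toChar Φ) A :=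
  fun _ _ h₁ h₂ => isIso_of_isIsometry_of_isPreStep h₁ h₂

/-- Every morphism of `F_Φ` is co-angular (the text obtains this from Prop. 1.4 (i); here it is
read off directly: isometric pre-steps are isomorphisms). [cite: MochizukiFrdI2008, Prop. 1.5] -/
theorem isCoAngular {A B : ElemFrobenioid Φ} (φ : A ⟶ B) : PreFrobenioid.IsCoAngular (toChar Φ) φ :=
  fun _ _ _ _ _ _ _ h₁ h₂ _ => isIso_of_isIsometry_of_isPreStep h₁ h₂

/-- The identity is a pre-step. [cite: MochizukiFrdI2008, Prop. 1.5] -/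
theorem isPreStep_id (A : ElemFrobenioid Φ) : PreFrobenioid.IsPreStep (toChar Φ) (𝟙 A) :=
  ⟨rfl, show IsIso (𝟙 A.base) from inferInstance⟩

/-- The identity is an isometry. [cite: MochizukiFrdI2008, Prop. 1.5] -/
theorem isIsometry_id (A : ElemFrobenioid Φ) : PreFrobenioid.IsIsometry (toChar Φ) (𝟙 A) :=
  Associates.mk_one

/-! ### "a morphism of `F_Φ` is a pull-back morphism if and only if it is a linear isometry" -/

/-- A pull-back morphism of `F_Φ` is a linear isometry (FrdI Prop. 1.5, proof).
[cite: MochizukiFrdI2008, Prop. 1.5] -/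
theorem degFr_div_of_isPullbackMorphism {A B : ElemFrobenioid Φ} {φ : A ⟶ B}
    (h : PreFrobenioid.IsPullbackMorphism (toChar Φ) φ) : degFr φ = 1 ∧ IsUnit (Div φ) := by
  obtain ⟨γ, hγ⟩ := (h A).2 ⟨(homMk (Base φ) 1 1, 𝟙 A.base), (Category.id_comp _).symm⟩
  have e1 : γ ≫ φ = homMk (Base φ) 1 1 :=
    congrArg (fun p : PreFrobenioid.PullbackHomData (toChar Φ) φ A => p.1.1) hγ
  have e2 : Base γ = 𝟙 A.base :=
    congrArg (fun p : PreFrobenioid.PullbackHomData (toChar Φ) φ A => p.1.2) hγ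
  have hn : degFr γ * degFr φ = 1 := congrArg Hom.degFr e1
  have hd : pull Φ (Base γ) (Div φ) * Div γ ^ (degFr φ : ℕ) = 1 := congrArg Hom.div e1
  have hφ : degFr φ = 1 := pnat_eq_one_of_mul_eq_one_left hn
  rw [e2, pull_id, hφ, PNat.one_coe, pow_one] at hd
  exact ⟨hφ, IsUnit.of_mul_eq_one _ hd⟩

/-- A linear isometry of `F_Φ` is a pull-back morphism, provided the `Φ(A)` are integral
(FrdI Prop. 1.5, proof). [cite: MochizukiFrdI2008, Prop. 1.5] -/
theorem isPullbackMorphism_of_degFr_div (hint : ∀ A : D, IsIntegral (Φ.obj (op A)))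
    {A B : ElemFrobenioid Φ} (φ : A ⟶ B) (hn : degFr φ = 1) (hu : IsUnit (Div φ)) :
    PreFrobenioid.IsPullbackMorphism (toChar Φ) φ := by
  obtain ⟨u, hu⟩ := hu
  intro X
  haveI : IsCancelMul (Φ.obj (op X.base)) := isIntegral_iff_isCancelMul.mp (hint X.base)
  constructor
  · intro γ γ' h
    have e1 : γ ≫ φ = γ' ≫ φ :=
      congrArg (fun p : PreFrobenioid.PullbackHomData (toChar Φ) φ X => p.1.1) h
    have e2 : Base γ = Base γ' :=
      congrArg (fun p : PreFrobenioid.PullbackHomData (toChar Φ) φ X => p.1.2) h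
    have hdeg : degFr γ * degFr φ = degFr γ' * degFr φ := congrArg Hom.degFr e1
    have hdiv : pull Φ (Base γ) (Div φ) * Div γ ^ (degFr φ : ℕ) =
        pull Φ (Base γ') (Div φ) * Div γ' ^ (degFr φ : ℕ) := congrArg Hom.div e1
    rw [e2, hn, PNat.one_coe, pow_one, pow_one] at hdiv
    exact Hom.ext e2 (mul_left_cancel hdiv) (mul_right_cancel hdeg)
  · rintro ⟨⟨δ, ε⟩, hδ⟩
    dsimp only at hδ
    let ε₀ : X.base ⟶ A.base := ε
    refine ⟨homMk ε₀ (↑(Units.map (pull Φ ε₀) u)⁻¹ * Div δ) (degFr δ), Subtype.ext (Prod.ext ?_ rfl)⟩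
    refine Hom.ext ?_ ?_ ?_
    · exact hδ.symm
    · show pull Φ ε₀ (Div φ) * (↑(Units.map (pull Φ ε₀) u)⁻¹ * Div δ) ^ (degFr φ : ℕ) = Div δ
      rw [hn, PNat.one_coe, pow_one, ← hu, ← Units.coe_map, Units.mul_inv_cancel_left]
    · show degFr δ * degFr φ = degFr δ
      rw [hn, mul_one]

/-! ### The homomorphism `N_{≥1} → End(A)` and powers in `End(A)` -/

/-- `ζ_A : N_{≥1} → End_{F_Φ}(A)`, `n ↦ (id, 0, n)`: the section of `deg_Fr` exhibiting `A` as
Frobenius-trivial. [cite: MochizukiFrdI2008, Prop. 1.5] -/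
def frobeniusSection (A : ElemFrobenioid Φ) : ℕ+ →* End A where
  toFun n := homMk (𝟙 A.base) 1 n
  map_one' := rfl
  map_mul' m n := by
    refine Hom.ext ?_ ?_ ?_
    · show 𝟙 A.base = 𝟙 A.base ≫ 𝟙 A.base
      rw [Category.id_comp]
    · show (1 : Φ.obj (op A.base)) = pull Φ (𝟙 A.base) 1 * 1 ^ ((m : ℕ+) : ℕ)
      rw [map_one, one_pow, mul_one]
    · show m * n = n * m
      exact mul_comm m n

/-- Powers in `End_{F_Φ}(A)` of a base-identity linear endomorphism `(id, a, 1)` are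
`(id, k · a, 1)`. [cite: MochizukiFrdI2008, Prop. 1.5] -/
theorem end_pow_eq {A : ElemFrobenioid Φ} (α : End A) (hb : Base (show A ⟶ A from α) = 𝟙 A.base)
    (hd : degFr (show A ⟶ A from α) = 1) (k : ℕ) :
    Base (show A ⟶ A from α ^ k) = 𝟙 A.base ∧
      Div (show A ⟶ A from α ^ k) = Div (show A ⟶ A from α) ^ k ∧
        degFr (show A ⟶ A from α ^ k) = 1 := by
  induction k with
  | zero =>
    rw [pow_zero, pow_zero]
    exact ⟨rfl, rfl, rfl⟩
  | succ k ih =>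
    obtain ⟨ih1, ih2, ih3⟩ := ih
    rw [pow_succ]
    refine ⟨?_, ?_, ?_⟩
    · show Base (show A ⟶ A from α) ≫ Base (show A ⟶ A from α ^ k) = 𝟙 A.base
      rw [hb, ih1, Category.id_comp]
    · show pull Φ (Base (show A ⟶ A from α)) (Div (show A ⟶ A from α ^ k)) *
          Div (show A ⟶ A from α) ^ (degFr (show A ⟶ A from α ^ k) : ℕ) =
        Div (show A ⟶ A from α) ^ (k + 1)
      rw [hb, pull_id, ih2, ih3, PNat.one_coe, pow_one, pow_succ]
    · show degFr (show A ⟶ A from α) * degFr (show A ⟶ A from α ^ k) = 1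
      rw [hd, ih3, mul_one]

/-! ### Proposition 1.5 (ii): `O^▷(A) ⥲ Φ(A)` and `O^×(A) ⥲ Φ(A)^±` -/

/-- **FrdI Prop. 1.5 (ii)**: the isomorphism `O^▷(A) ⥲ Φ(A)`, `α = (id, a, 1) ↦ a = Div(α)`.
[cite: MochizukiFrdI2008, Prop. 1.5] -/
def endEquiv (A : ElemFrobenioid Φ) :
    PreFrobenioid.endSubmonoid (toChar Φ) A ≃* Φ.obj (op A.base) where
  toFun α := Div (show A ⟶ A from α.1)
  invFun x := ⟨homMk (𝟙 A.base) x 1, show _ ∧ _ from ⟨rfl, rfl⟩⟩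
  left_inv α := by
    have h₁ : Base (show A ⟶ A from α.1) = 𝟙 A.base := α.2.1
    have h₂ : degFr (show A ⟶ A from α.1) = 1 := α.2.2
    exact Subtype.ext (Hom.ext h₁.symm rfl h₂.symm)
  right_inv _ := rfl
  map_mul' α β := by
    have hβ : Base (show A ⟶ A from β.1) = 𝟙 A.base := β.2.1
    have hα : degFr (show A ⟶ A from α.1) = 1 := α.2.2
    show pull Φ (Base (show A ⟶ A from β.1)) (Div (show A ⟶ A from α.1)) *
        Div (show A ⟶ A from β.1) ^ (degFr (show A ⟶ A from α.1) : ℕ) =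
      Div (show A ⟶ A from α.1) * Div (show A ⟶ A from β.1)
    rw [hβ, pull_id, hα, PNat.one_coe, pow_one]

/-- `O^▷(A) ⥲ Φ(A)` is `α ↦ Div(α)`. [cite: MochizukiFrdI2008, Prop. 1.5] -/
@[simp] theorem endEquiv_apply (A : ElemFrobenioid Φ) (α : PreFrobenioid.endSubmonoid (toChar Φ) A) :
    endEquiv A α = Div (show A ⟶ A from α.1) := rfl

/-- For `α ∈ O^×(A)`, `Div(α) · Div(α⁻¹) = 0`. [cite: MochizukiFrdI2008, Prop. 1.5] -/
private theorem div_hom_mul_div_inv {A : ElemFrobenioid Φ}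
    (α : PreFrobenioid.unitsSubgroup (toChar Φ) A) :
    Div (show A ⟶ A from α.1.hom) * Div (show A ⟶ A from α.1.inv) = 1 := by
  have hb : Base (show A ⟶ A from α.1.hom) = 𝟙 A.base := α.2.1
  have hd : degFr (show A ⟶ A from α.1.hom) = 1 := α.2.2
  have hb' : Base (show A ⟶ A from α.1.inv) = 𝟙 A.base :=
    ((PreFrobenioid.unitsSubgroup (toChar Φ) A).inv_mem α.2).1
  have h : pull Φ (Base (show A ⟶ A from α.1.inv)) (Div (show A ⟶ A from α.1.hom)) *
      Div (show A ⟶ A from α.1.inv) ^ (degFr (show A ⟶ A from α.1.hom) : ℕ) = 1 := by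
    rw [← div_comp, Iso.inv_hom_id, div_id]
  rwa [hb', pull_id, hd, PNat.one_coe, pow_one] at h

/-- **FrdI Prop. 1.5 (ii)**, units: `O^×(A) ⥲ Φ(A)^±`, `α ↦ Div(α)`. [cite: MochizukiFrdI2008, Prop. 1.5] -/
noncomputable def unitsEquiv (A : ElemFrobenioid Φ) :
    PreFrobenioid.unitsSubgroup (toChar Φ) A ≃* (Φ.obj (op A.base))ˣ where
  toFun α := Units.mkOfMulEqOne _ _ (div_hom_mul_div_inv α)
  invFun u := ⟨@asIso _ _ _ _ (homMk (𝟙 A.base) (u : Φ.obj (op A.base)) 1) (isIso_homMk _ u.isUnit),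
    show _ ∧ _ from ⟨rfl, rfl⟩⟩
  left_inv α := by
    have h₁ : Base (show A ⟶ A from α.1.hom) = 𝟙 A.base := α.2.1
    have h₂ : degFr (show A ⟶ A from α.1.hom) = 1 := α.2.2
    exact Subtype.ext (Iso.ext (Hom.ext h₁.symm rfl h₂.symm))
  right_inv _ := Units.ext rfl
  map_mul' α β := by
    have hβ : Base (show A ⟶ A from β.1.hom) = 𝟙 A.base := β.2.1
    have hα : degFr (show A ⟶ A from α.1.hom) = 1 := α.2.2
    apply Units.ext
    show pull Φ (Base (show A ⟶ A from β.1.hom)) (Div (show A ⟶ A from α.1.hom)) *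
        Div (show A ⟶ A from β.1.hom) ^ (degFr (show A ⟶ A from α.1.hom) : ℕ) =
      Div (show A ⟶ A from α.1.hom) * Div (show A ⟶ A from β.1.hom)
    rw [hβ, pull_id, hα, PNat.one_coe, pow_one]

/-- `O^×(A) ⥲ Φ(A)^±` is `α ↦ Div(α)`. [cite: MochizukiFrdI2008, Prop. 1.5] -/
@[simp] theorem coe_unitsEquiv_apply (A : ElemFrobenioid Φ)
    (α : PreFrobenioid.unitsSubgroup (toChar Φ) A) :
    (unitsEquiv A α : Φ.obj (op A.base)) = Div (show A ⟶ A from α.1.hom) := rfl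
end ElemFrobenioid

end Literature.AlgebraicGeometry.Frobenioids
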